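import Summits.BirchSwinnertonDyer.Rank1Residual.Additive.GoodModelKernelH1OfDeeplyRamified
import HarnessLib

/-!
# `H¹(G, Ŵ₀(𝔪̄)) = 0` in cocycle form from ONE trace element per layer, with a prescribed open zero level

The engine-caller `KernelH1.exists_eq_smul_sub_of_deeplyRamifiedTrace` (cell `b2b-bsdres`,
`Rank1Residual/Additive/GoodModelKernelH1OfDeeplyRamified.lean`: [CoGr] Cor. 3.2 by the Coates–Greenberg
successive approximation) with its ONE use of the deeply-ramified trace fact `hDR` replaced by a
hypothesis `htr` on the closed group `G` alone (for every open `O` above a NORMAL subgroup `G₁ ≤ Γ_{K_v}`: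
an `O ∩ G`-fixed `x`, `|x| ≤ 1`, with orbit sum over `G/(G ∩ O)` of absolute value `1` — e.g. the
unit-trace element of an UNRAMIFIED finite quotient, `UnramifiedQuotientTraceProofs`, when
`G ∩ I_{K_v} ≤ G₁`), the zero level of the cocycle supplied as an OPEN subgroup `O₀ ≥ G₁` (its fixed
field `L₀` is finite over `K_v`, `InfiniteGalois.isOpen_iff_finite` / `fixingSubgroup_fixedField`), the
values of the cocycle `G₁`-fixed and the change `C` to the good model `K_v`-rational.  New step: `G₁`
fixes the finite normal layer `M₁ = ncl(L₀ ⊔ K_v(S₀))` (it fixes `L₀`, the coordinates of the values,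
the entries of `C`, and is normal, `IntermediateField.normalClosure_def''`), so `G₁ ≤ Gal(K̄_v/M₁)` and
`htr` replaces `hDR`; everything else is the cited proof verbatim.  THEOREMS ONLY.  Consumer: the
frame-restricted discharge of Greenberg's Prop. 2.4 (LNM 1716) above a split prime in the anticyclotomic
tower (cell `pub/bsd-print-x9`, stmt-BirchSwinnertonDyer-23237; `G = (ker κ)_v`,
`G₁ = (ker κ)_v ∩ (ker κ^{cyc})_v`).  References: [CoatesGreenberg1996] §3 Thm. 3.1 / Cor. 3.2, §2
p. 143; [GreenbergLNM1716] pp. 36–37, 83–84; [Bondarko2007FormalGroupsSurvey] Thm. 9.2;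
[SerreLocalFields1979] Ch. V §1.
-/

-- the summit namespace `Summit.BirchSwinnertonDyer.BirchSwinnertonDyer` repeats the problem name by design (D-0017)
set_option linter.dupNamespace false

noncomputable section

open scoped Classical NNReal

open WeierstrassCurve NumberField IsDedekindDomain Field
  Literature.NumberTheory.GaloisRepresentations Literature.NumberTheory.EllipticCurves
  Literature.NumberTheory.EllipticCurves.FormalGroupChart IsDedekindDomain.HeightOneSpectrum
  Summit.BirchSwinnertonDyer.Rank1Residual.Additive.GoodModelLine
  Summit.BirchSwinnertonDyer.Rank1Residual.Additive.GoodModelLine.KernelH1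

universe u

namespace Summit.BirchSwinnertonDyer.BirchSwinnertonDyer.Theorems.KernelH1OfTrace

variable {K : Type u} [Field K] [NumberField K] {v : HeightOneSpectrum (𝓞 K)}

set_option maxHeartbeats 1600000 in
/-- **`H¹(G, Ŵ₀(𝔪̄)) = 0` from one trace element per layer, with a prescribed zero level** — the
Coates–Greenberg successive approximation ([CoGr] Thm. 3.1 / Cor. 3.2) for a good model `W₀ = C • E`
(`C` rational over `K_v`), a closed `G ≤ Γ_{K_v}`, a normal `G₁ ≤ Γ_{K_v}`, an OPEN zero level
`O₀ ≥ G₁` (`φ` vanishes on `G ∩ O₀`; its fixed field `L₀ = K̄_v^{O₀}` is finite over `K_v` by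
`InfiniteGalois.isOpen_iff_finite`), the values of `φ` being `G₁`-fixed and in `Ŵ₀(𝔪̄)`: if every open `O ≥ G₁` carries an `O ∩ G`-fixed
`x` with `|x| ≤ 1` and orbit sum over `G/(G ∩ O)` of absolute value `1` (`htr`), then `φ` is the
coboundary of a point of `Ŵ₀(𝔪̄)`.  Proof = `KernelH1.exists_eq_smul_sub_of_deeplyRamifiedTrace`
with `hDR` replaced by `htr` at the layer `M₁ = ncl(L₀ ⊔ K_v(S₀))`, which `G₁` fixes.
[cite: CoatesGreenberg1996, §3 Thm. 3.1 and Cor. 3.2 (through GreenbergLNM1716, Coates pp. 36–37 eq. (74), Greenberg pp. 83–84)]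
[cite: Bondarko2007FormalGroupsSurvey, §9.2 Thm. 9.2] [cite: SerreLocalFields1979, Ch. V §1] -/
theorem exists_eq_smul_sub_of_trace
    (W : WeierstrassCurve K) [W.IsElliptic] (w : Valuation (AlgebraicClosure (v.adicCompletion K)) ℝ≥0)
    (hw : ∀ x, (w x : ℝ) = spectralNorm (v.adicCompletion K) (AlgebraicClosure (v.adicCompletion K)) x) (C : VariableChange (AlgebraicClosure (v.adicCompletion K)))
    (W₀ : WeierstrassCurve w.integer)
    (hW₀ : C • (W.baseChange (v.adicCompletion K)).baseChange (AlgebraicClosure (v.adicCompletion K)) = W₀.baseChange (AlgebraicClosure (v.adicCompletion K))) (hΔ : IsUnit W₀.Δ)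
    (hC : ∀ τ : absoluteGaloisGroup (v.adicCompletion K), C.map ((absoluteGaloisGroup.toAlgEquiv (v.adicCompletion K) τ : (AlgebraicClosure (v.adicCompletion K)) ≃ₐ[(v.adicCompletion K)] (AlgebraicClosure (v.adicCompletion K))) : (AlgebraicClosure (v.adicCompletion K)) →+* (AlgebraicClosure (v.adicCompletion K))) = C)
    (G : Subgroup (absoluteGaloisGroup (v.adicCompletion K))) (hGc : IsClosed (G : Set (absoluteGaloisGroup (v.adicCompletion K))))
    (G₁ : Subgroup (absoluteGaloisGroup (v.adicCompletion K))) [G₁.Normal]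
    (htr : ∀ O : Subgroup (absoluteGaloisGroup (v.adicCompletion K)),
      IsOpen (O : Set (absoluteGaloisGroup (v.adicCompletion K))) → G₁ ≤ O →
      ∀ [Fintype (G ⧸ O.subgroupOf G)],
        ∃ x : AlgebraicClosure (v.adicCompletion K), w x ≤ 1 ∧ (∀ u ∈ O ⊓ G, u • x = x) ∧
          w (∑ q : G ⧸ O.subgroupOf G, ((q.out : G) : absoluteGaloisGroup (v.adicCompletion K)) • x) = 1)
    (O₀ : Subgroup (absoluteGaloisGroup (v.adicCompletion K)))
    (hO₀ : IsOpen (O₀ : Set (absoluteGaloisGroup (v.adicCompletion K)))) (hG₁O₀ : G₁ ≤ O₀)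
    (φ : contOneCocycles (discreteTopRep G (localPoints W (v.adicCompletion K))))
    (hφO₀ : ∀ u : G, (u : absoluteGaloisGroup (v.adicCompletion K)) ∈ O₀ → φ.1 u = 0)
    (hG₁φ : ∀ g ∈ G₁, ∀ h : G, g • φ.1 h = φ.1 h)
    (hφ : ∀ g, Affine.Point.congrEquiv hW₀ (VariableChange.pointEquiv _ C
      (Affine.Point.congrEquiv (baseChange_baseChange_adicCompletion W v).symm (φ.1 g))) ∈
        kernelOfReduction W₀ (Valuation.integer.integers w)) :
    ∃ a : localPoints W (v.adicCompletion K), Affine.Point.congrEquiv hW₀ (VariableChange.pointEquiv _ C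
        (Affine.Point.congrEquiv (baseChange_baseChange_adicCompletion W v).symm a)) ∈
          kernelOfReduction W₀ (Valuation.integer.integers w) ∧
      ∀ g : G, φ.1 g = g • a - a := by
  have hGC : ∀ σ ∈ G, C.map ((absoluteGaloisGroup.toAlgEquiv (v.adicCompletion K) σ : (AlgebraicClosure (v.adicCompletion K)) ≃ₐ[(v.adicCompletion K)] (AlgebraicClosure (v.adicCompletion K))) : (AlgebraicClosure (v.adicCompletion K)) →+* (AlgebraicClosure (v.adicCompletion K))) = C :=
    fun σ _ ↦ hC σ
  haveI hGal := isGalois_algebraicClosure_adicCompletion (v := v)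
  haveI : CharZero (v.adicCompletion K) := charZero_of_injective_algebraMap (algebraMap K (v.adicCompletion K)).injective
  haveI hVint : (W₀.baseChange (AlgebraicClosure (v.adicCompletion K))).IsIntegral w.integer := ⟨⟨W₀, rfl⟩⟩
  haveI hVell : (W₀.baseChange (AlgebraicClosure (v.adicCompletion K))).IsElliptic := by
    rw [isElliptic_iff, baseChange, map_Δ]
    exact hΔ.map _
  have hvw : w.Integers w.integer := Valuation.integer.integers w
  set O₀' : Subgroup ((AlgebraicClosure (v.adicCompletion K)) ≃ₐ[v.adicCompletion K] (AlgebraicClosure (v.adicCompletion K))) :=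
    O₀.comap (absoluteGaloisGroup.toAlgEquiv (v.adicCompletion K)).symm.toMonoidHom with hO₀'def
  have hO₀'mem : ∀ e, e ∈ O₀' ↔ (absoluteGaloisGroup.toAlgEquiv (v.adicCompletion K)).symm e ∈ O₀ :=
    fun _ ↦ Subgroup.mem_comap
  have hO₀'open : IsOpen (O₀' : Set ((AlgebraicClosure (v.adicCompletion K)) ≃ₐ[v.adicCompletion K] (AlgebraicClosure (v.adicCompletion K)))) := hO₀
  have hO₀'closed : IsClosed (O₀' : Set ((AlgebraicClosure (v.adicCompletion K)) ≃ₐ[v.adicCompletion K] (AlgebraicClosure (v.adicCompletion K)))) :=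
    Subgroup.isClosed_of_isOpen _ hO₀'open
  set L₀ : IntermediateField (v.adicCompletion K) (AlgebraicClosure (v.adicCompletion K)) :=
    IntermediateField.fixedField O₀' with hL₀def
  have hL₀fix : L₀.fixingSubgroup = O₀' :=
    InfiniteGalois.fixingSubgroup_fixedField ⟨O₀', hO₀'closed⟩
  haveI hL₀fin : FiniteDimensional (v.adicCompletion K) L₀ :=
    (InfiniteGalois.isOpen_iff_finite L₀).mp (by rw [hL₀fix]; exact hO₀'open)
  have hφL₀ : ∀ u : G, absoluteGaloisGroup.toAlgEquiv (v.adicCompletion K)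
      (u : absoluteGaloisGroup (v.adicCompletion K)) ∈ L₀.fixingSubgroup → φ.1 u = 0 := by
    intro u hu
    rw [hL₀fix, hO₀'mem, MulEquiv.symm_apply_apply] at hu
    exact hφO₀ u hu
  have hG₁L₀ : ∀ g ∈ G₁, absoluteGaloisGroup.toAlgEquiv (v.adicCompletion K) g ∈ L₀.fixingSubgroup := by
    intro g hg
    rw [hL₀fix, hO₀'mem, MulEquiv.symm_apply_apply]
    exact hG₁O₀ hg
  set Φ : localPoints W (v.adicCompletion K) ≃+ (W₀.baseChange (AlgebraicClosure (v.adicCompletion K))).toAffine.Point :=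
    ((Affine.Point.congrEquiv (baseChange_baseChange_adicCompletion W v).symm).trans
      (VariableChange.pointEquiv _ C)).trans (Affine.Point.congrEquiv hW₀) with hΦdef
  have hΦ : ∀ P, Φ P = Affine.Point.congrEquiv hW₀ (VariableChange.pointEquiv _ C
      (Affine.Point.congrEquiv (baseChange_baseChange_adicCompletion W v).symm P)) := fun _ ↦ rfl
  set T : (absoluteGaloisGroup (v.adicCompletion K)) → (W₀.baseChange (AlgebraicClosure (v.adicCompletion K))).toAffine.Point →+ (W₀.baseChange (AlgebraicClosure (v.adicCompletion K))).toAffine.Point :=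
    fun g ↦ Φ.toAddMonoidHom.comp
      ((DistribSMul.toAddMonoidHom (localPoints W (v.adicCompletion K)) g).comp Φ.symm.toAddMonoidHom) with hTdef
  have hT : ∀ g P, T g P = Φ (g • Φ.symm P) := fun _ _ ↦ rfl
  set σ : (absoluteGaloisGroup (v.adicCompletion K)) → ((AlgebraicClosure (v.adicCompletion K)) ≃+* (AlgebraicClosure (v.adicCompletion K))) := fun g ↦ ((absoluteGaloisGroup.toAlgEquiv (v.adicCompletion K) g : (AlgebraicClosure (v.adicCompletion K)) ≃ₐ[(v.adicCompletion K)] (AlgebraicClosure (v.adicCompletion K))).toRingEquiv) with hσdef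
  have hσ : ∀ g z, σ g z = g • z := fun _ _ ↦ rfl
  have hσw : ∀ g z, w (σ g z) = w z := fun g z ↦ spectralValuation_smul hw g z
  have hTsome : ∀ g : (absoluteGaloisGroup (v.adicCompletion K)), C.map ((absoluteGaloisGroup.toAlgEquiv (v.adicCompletion K) g : (AlgebraicClosure (v.adicCompletion K)) ≃ₐ[(v.adicCompletion K)] (AlgebraicClosure (v.adicCompletion K))) : (AlgebraicClosure (v.adicCompletion K)) →+* (AlgebraicClosure (v.adicCompletion K))) = C →
      ∀ {x y : (AlgebraicClosure (v.adicCompletion K))} {h : (W₀.baseChange (AlgebraicClosure (v.adicCompletion K))).toAffine.Nonsingular x y},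
      ∃ h', T g (.some x y h) = .some (σ g x) (σ g y) h' := by
    intro g hgC x y h
    have hP : Affine.Point.congrEquiv hW₀ (VariableChange.pointEquiv _ C
        (Affine.Point.congrEquiv (baseChange_baseChange_adicCompletion W v).symm
          (Φ.symm (.some x y h)))) = .some x y h := by
      rw [← hΦ, AddEquiv.apply_symm_apply]
    obtain ⟨h', e⟩ := transport_smul_of_eq_some W v C hW₀ g hgC (Φ.symm (.some x y h)) hP
    exact ⟨h', by rw [hT, hΦ, e]; rfl⟩
  have hTC_ker : ∀ g, C.map ((absoluteGaloisGroup.toAlgEquiv (v.adicCompletion K) g : (AlgebraicClosure (v.adicCompletion K)) ≃ₐ[(v.adicCompletion K)] (AlgebraicClosure (v.adicCompletion K))) : (AlgebraicClosure (v.adicCompletion K)) →+* (AlgebraicClosure (v.adicCompletion K))) = C →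
      ∀ P, P ∈ kernel w (W₀.baseChange (AlgebraicClosure (v.adicCompletion K))) →
        T g P ∈ kernel w (W₀.baseChange (AlgebraicClosure (v.adicCompletion K))) ∧ (T g P).zCoord = σ g P.zCoord := by
    intro g hgC P hPK
    rcases P with _ | ⟨x, y, h⟩
    · rw [← WeierstrassCurve.Affine.Point.zero_def, map_zero, WeierstrassCurve.Affine.Point.zCoord_zero,
        map_zero]
      exact ⟨(kernel w _).zero_mem, rfl⟩
    · obtain ⟨h', e⟩ := hTsome g hgC (x := x) (y := y) (h := h)
      rw [e, WeierstrassCurve.Affine.Point.zCoord_some, WeierstrassCurve.Affine.Point.zCoord_some,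
        some_mem_kernel_iff, hσw, map_div₀, map_neg]
      exact ⟨(some_mem_kernel_iff h).mp hPK, rfl⟩
  have hGC' : ∀ g : G, C.map ((absoluteGaloisGroup.toAlgEquiv (v.adicCompletion K) (g : (absoluteGaloisGroup (v.adicCompletion K))) : (AlgebraicClosure (v.adicCompletion K)) ≃ₐ[(v.adicCompletion K)] (AlgebraicClosure (v.adicCompletion K))) : (AlgebraicClosure (v.adicCompletion K)) →+* (AlgebraicClosure (v.adicCompletion K))) = C := fun g ↦ hGC g g.2
  have hTmul : ∀ g h P, T (g * h) P = T g (T h P) := by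
    intro g h P
    rw [hT, hT, hT, AddEquiv.symm_apply_apply, mul_smul]
  set c : G → (W₀.baseChange (AlgebraicClosure (v.adicCompletion K))).toAffine.Point := fun g ↦ Φ (φ.1 g) with hcdef
  have hc_apply : ∀ g, c g = Φ (φ.1 g) := fun _ ↦ rfl
  have hcK : ∀ g, c g ∈ kernel w (W₀.baseChange (AlgebraicClosure (v.adicCompletion K))) := by
    intro g
    rw [hc_apply, mem_kernel_iff_reducesToZero W₀, ← mem_kernelOfReduction_iff hvw, hΦ]
    exact hφ g
  have hcoc : ∀ g h : G, c (g * h) = c g + T (g : (absoluteGaloisGroup (v.adicCompletion K))) (c h) := by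
    intro g h
    rw [hc_apply, hc_apply, hc_apply, hT, AddEquiv.symm_apply_apply, φ.2 g h, map_add,
      discreteTopRep_ρ_apply]
    rfl
  haveI : CompactSpace G := isCompact_iff_compactSpace.mp hGc.isCompact
  have hfin_range : (Set.range φ.1).Finite := (isCompact_range φ.1.continuous).finite_of_discrete
  set S₀ : Set (AlgebraicClosure (v.adicCompletion K)) :=
    {z | ∃ P ∈ Set.range c, ∃ x y, ∃ h : (W₀.baseChange (AlgebraicClosure (v.adicCompletion K))).toAffine.Nonsingular x y,
        P = .some x y h ∧ (z = x ∨ z = y)} ∪ ({(C.u : (AlgebraicClosure (v.adicCompletion K))), C.r, C.s, C.t} : Set (AlgebraicClosure (v.adicCompletion K))) with hS₀def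
  have hfin_c : (Set.range c).Finite :=
    Set.Finite.subset (hfin_range.image Φ) (by rintro _ ⟨g, rfl⟩; exact ⟨φ.1 g, ⟨g, rfl⟩, rfl⟩)
  have hS₀fin : S₀.Finite := Set.Finite.union (finite_coords hfin_c) (Set.toFinite _)
  haveI : Finite S₀ := hS₀fin.to_subtype
  haveI hS₀fd : FiniteDimensional (v.adicCompletion K) (IntermediateField.adjoin (v.adicCompletion K) S₀) :=
    IntermediateField.finiteDimensional_adjoin fun z _ ↦
      (Algebra.IsAlgebraic.isAlgebraic (R := (v.adicCompletion K)) z).isIntegral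
  set M₀ : IntermediateField (v.adicCompletion K) (AlgebraicClosure (v.adicCompletion K)) := L₀ ⊔ IntermediateField.adjoin (v.adicCompletion K) S₀ with hM₀def
  haveI : FiniteDimensional (v.adicCompletion K) M₀ := IntermediateField.finiteDimensional_sup _ _
  set M₁ : IntermediateField (v.adicCompletion K) (AlgebraicClosure (v.adicCompletion K)) := IntermediateField.normalClosure (v.adicCompletion K) M₀ (AlgebraicClosure (v.adicCompletion K)) with hM₁def
  haveI hM₁fd : FiniteDimensional (v.adicCompletion K) M₁ := by rw [hM₁def]; infer_instance
  haveI hM₁n : Normal (v.adicCompletion K) M₁ := by rw [hM₁def]; infer_instance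
  have hM₀M₁ : M₀ ≤ M₁ := by rw [hM₁def]; exact IntermediateField.le_normalClosure M₀
  have hL₀M₁ : L₀ ≤ M₁ := by
    refine le_trans ?_ hM₀M₁
    rw [hM₀def]; exact le_sup_left
  have hS₀M₁ : S₀ ⊆ (M₁ : Set (AlgebraicClosure (v.adicCompletion K))) := by
    refine (IntermediateField.subset_adjoin (v.adicCompletion K) S₀).trans ?_
    have h : IntermediateField.adjoin (v.adicCompletion K) S₀ ≤ M₁ := le_trans (by rw [hM₀def]; exact le_sup_right) hM₀M₁
    exact h
  set O : Subgroup (absoluteGaloisGroup (v.adicCompletion K)) := M₁.fixingSubgroup.comap (absoluteGaloisGroup.toAlgEquiv (v.adicCompletion K)).toMonoidHom with hOdef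
  have hO_mem : ∀ τ, τ ∈ O ↔ absoluteGaloisGroup.toAlgEquiv (v.adicCompletion K) τ ∈ M₁.fixingSubgroup := fun _ ↦ Subgroup.mem_comap
  have hOopen : IsOpen (O : Set (absoluteGaloisGroup (v.adicCompletion K))) := M₁.fixingSubgroup_isOpen
  set U : Subgroup G := O.subgroupOf G with hUdef
  haveI : Finite (G ⧸ U) := finite_quotient_subgroupOf_fixingSubgroup M₁ G
  letI : Fintype (G ⧸ U) := Fintype.ofFinite _
  have hUt : ∀ u : G, u ∈ U → φ.1 u = 0 := fun u hu ↦ hφL₀ u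
    (IntermediateField.fixingSubgroup_le hL₀M₁ ((hO_mem _).mp (Subgroup.mem_subgroupOf.mp hu)))
  have hcU : ∀ u ∈ U, c u = 0 := fun u hu ↦ by rw [hc_apply, hUt u hu, map_zero]
  set ρ₀ : ℝ≥0 := hfin_range.toFinset.sup fun P ↦ w (Φ P).zCoord with hρ₀def
  have hρ₀lt : ρ₀ < 1 := by
    rw [hρ₀def, Finset.sup_lt_iff (bot_lt_iff_ne_bot.mpr one_ne_zero)]
    intro P hP
    obtain ⟨g, rfl⟩ := hfin_range.mem_toFinset.mp hP
    exact val_zCoord_lt_one (hcK g)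
  have hcρ₀ : ∀ g, w (c g).zCoord ≤ ρ₀ :=
    fun g ↦ Finset.le_sup (f := fun P ↦ w (Φ P).zCoord) (hfin_range.mem_toFinset.mpr ⟨g, rfl⟩)
  have hsqrt : NNReal.sqrt ρ₀ < 1 := by rw [← NNReal.sqrt_one]; exact NNReal.sqrt_lt_sqrt.mpr hρ₀lt
  have hG₁O : G₁ ≤ O := by
    set G₁' : Subgroup ((AlgebraicClosure (v.adicCompletion K)) ≃ₐ[v.adicCompletion K] (AlgebraicClosure (v.adicCompletion K))) :=
      G₁.map (absoluteGaloisGroup.toAlgEquiv (v.adicCompletion K)).toMonoidHom with hG₁'def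
    have hG₁'n : G₁'.Normal :=
      Subgroup.Normal.map inferInstance _ (absoluteGaloisGroup.toAlgEquiv (v.adicCompletion K)).surjective
    have hG₁'_mem : ∀ e, e ∈ G₁' ↔ ∃ g ∈ G₁, absoluteGaloisGroup.toAlgEquiv (v.adicCompletion K) g = e :=
      fun e ↦ Subgroup.mem_map
    have hfixS₀ : S₀ ⊆ (IntermediateField.fixedField G₁' : Set (AlgebraicClosure (v.adicCompletion K))) := by
      intro z hz
      rw [SetLike.mem_coe, IntermediateField.mem_fixedField_iff]
      intro e he
      obtain ⟨g, hg, rfl⟩ := (hG₁'_mem e).mp he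
      rcases hz with ⟨P, ⟨h, rfl⟩, X, Y, hXY, hP, hzXY⟩ | hzC
      · -- coordinates of `c h`, fixed because `g • φ h = φ h`
        have hTc : T g (c h) = c h := by
          rw [hT, hc_apply, AddEquiv.symm_apply_apply, hG₁φ g hg h]
        obtain ⟨h', e'⟩ := hTsome g (hC g) (x := X) (y := Y) (h := hXY)
        rw [hP] at hTc
        have hinj := e'.symm.trans hTc
        simp only [WeierstrassCurve.Affine.Point.some.injEq] at hinj
        rcases hzXY with rfl | rfl
        · exact hinj.1
        · exact hinj.2
      · -- entries of `C`
        have hCg := hC g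
        simp only [Set.mem_insert_iff, Set.mem_singleton_iff] at hzC
        rcases hzC with rfl | rfl | rfl | rfl
        · have := congrArg (fun D : VariableChange (AlgebraicClosure (v.adicCompletion K)) ↦ (D.u : AlgebraicClosure (v.adicCompletion K))) hCg
          simpa [VariableChange.map] using this
        · have := congrArg VariableChange.r hCg
          simpa [VariableChange.map] using this
        · have := congrArg VariableChange.s hCg
          simpa [VariableChange.map] using this
        · have := congrArg VariableChange.t hCg
          simpa [VariableChange.map] using this
    have hfixL₀ : L₀ ≤ IntermediateField.fixedField G₁' := by
      intro z hz
      rw [IntermediateField.mem_fixedField_iff]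
      intro e he
      obtain ⟨g, hg, rfl⟩ := (hG₁'_mem e).mp he
      have hgL₀ := hG₁L₀ g hg
      rw [IntermediateField.mem_fixingSubgroup_iff] at hgL₀
      exact hgL₀ z hz
    have hfixM₀ : M₀ ≤ IntermediateField.fixedField G₁' := by
      rw [hM₀def]
      exact sup_le hfixL₀ (IntermediateField.adjoin_le_iff.mpr hfixS₀)
    have hfixM₁ : M₁ ≤ IntermediateField.fixedField G₁' := by
      rw [hM₁def, IntermediateField.normalClosure_def'']
      refine iSup_le fun f ↦ ?_
      intro z hz
      rw [IntermediateField.mem_map] at hz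
      obtain ⟨y, hy, rfl⟩ := hz
      rw [IntermediateField.mem_fixedField_iff]
      intro e he
      have he' : f⁻¹ * e * f ∈ G₁' := hG₁'n.conj_mem' e he f
      have hy' := (IntermediateField.mem_fixedField_iff _ _).mp (hfixM₀ hy) _ he'
      rw [AlgEquiv.mul_apply, AlgEquiv.mul_apply] at hy'
      have h2 := congrArg f hy'
      rwa [← AlgEquiv.mul_apply, mul_inv_cancel, AlgEquiv.one_apply] at h2
    intro g hg
    rw [hO_mem, IntermediateField.mem_fixingSubgroup_iff]
    intro z hz
    exact (IntermediateField.mem_fixedField_iff _ _).mp (hfixM₁ hz) _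
      ((hG₁'_mem _).mpr ⟨g, hg, rfl⟩)
  obtain ⟨x, hx1, hxU, hxw⟩ := htr O hOopen hG₁O
  have hxtr : NNReal.sqrt ρ₀ < w (∑ q : G ⧸ O.subgroupOf G,
      ((q.out : G) : (absoluteGaloisGroup (v.adicCompletion K))) • x) := by
    rw [hxw]; exact hsqrt
  have hsum_eq : (∑ q : G ⧸ U, σ ((q.out : G) : (absoluteGaloisGroup (v.adicCompletion K))) x) =
      ∑ q : G ⧸ O.subgroupOf G, ((q.out : G) : (absoluteGaloisGroup (v.adicCompletion K))) • x := rfl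
  have hηpos : 0 < w (∑ q : G ⧸ U, σ ((q.out : G) : (absoluteGaloisGroup (v.adicCompletion K))) x) := lt_of_le_of_lt zero_le (hsum_eq ▸ hxtr)
  have hη2 : ρ₀ < w (∑ q : G ⧸ U, σ ((q.out : G) : (absoluteGaloisGroup (v.adicCompletion K))) x) ^ 2 := by
    rw [hsum_eq]
    exact NNReal.sqrt_lt_sqrt.mp (by rw [NNReal.sqrt_sq]; exact hxtr :
      NNReal.sqrt ρ₀ < NNReal.sqrt (w (∑ q : G ⧸ O.subgroupOf G, ((q.out : G) : (absoluteGaloisGroup (v.adicCompletion K))) • x) ^ 2))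
  set orb : Set (AlgebraicClosure (v.adicCompletion K)) := Set.range fun q : G ⧸ U ↦ ((q.out : G) : (absoluteGaloisGroup (v.adicCompletion K))) • x with horbdef
  haveI : Finite orb := Set.finite_range _ |>.to_subtype
  haveI : FiniteDimensional (v.adicCompletion K) (IntermediateField.adjoin (v.adicCompletion K) orb) :=
    IntermediateField.finiteDimensional_adjoin fun z _ ↦
      (Algebra.IsAlgebraic.isAlgebraic (R := (v.adicCompletion K)) z).isIntegral
  set Kn : IntermediateField (v.adicCompletion K) (AlgebraicClosure (v.adicCompletion K)) := M₁ ⊔ IntermediateField.adjoin (v.adicCompletion K) orb with hKndef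
  haveI hKnfd : FiniteDimensional (v.adicCompletion K) Kn := IntermediateField.finiteDimensional_sup _ _
  have hM₁Kn : M₁ ≤ Kn := le_sup_left
  have hxorb : x ∈ orb := by
    have h := smul_mem_range_out_smul M₁ G x hxU (1 : G)
    rw [Subgroup.coe_one, one_smul] at h
    exact h
  have hxKn : x ∈ Kn := (le_sup_right : _ ≤ Kn) (IntermediateField.subset_adjoin _ _ hxorb)
  have hKnG : ∀ g : G, ∀ z ∈ Kn, (g : (absoluteGaloisGroup (v.adicCompletion K))) • z ∈ Kn :=
    fun g z hz ↦ smul_mem_orbitLayer M₁ G x hxU g hz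
  have hUKn : ∀ u : G, u ∈ U → ∀ z ∈ Kn, (u : (absoluteGaloisGroup (v.adicCompletion K))) • z = z :=
    fun u hu z hz ↦ smul_eq_self_of_mem_orbitLayer M₁ G x hxU ⟨Subgroup.mem_subgroupOf.mp hu, u.2⟩ hz
  have hKnC : ∀ τ : (absoluteGaloisGroup (v.adicCompletion K)), absoluteGaloisGroup.toAlgEquiv (v.adicCompletion K) τ ∈ Kn.fixingSubgroup → C.map ((absoluteGaloisGroup.toAlgEquiv (v.adicCompletion K) τ : (AlgebraicClosure (v.adicCompletion K)) ≃ₐ[(v.adicCompletion K)] (AlgebraicClosure (v.adicCompletion K))) : (AlgebraicClosure (v.adicCompletion K)) →+* (AlgebraicClosure (v.adicCompletion K))) = C := by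
    intro τ hτ
    rw [IntermediateField.mem_fixingSubgroup_iff] at hτ
    have hfix : ∀ z ∈ S₀, (absoluteGaloisGroup.toAlgEquiv (v.adicCompletion K) τ) z = z := fun z hz ↦ hτ z (hM₁Kn (hS₀M₁ hz))
    have hu : (absoluteGaloisGroup.toAlgEquiv (v.adicCompletion K) τ) (C.u : (AlgebraicClosure (v.adicCompletion K))) = C.u := hfix _ (Or.inr (by simp))
    have hr : (absoluteGaloisGroup.toAlgEquiv (v.adicCompletion K) τ) C.r = C.r := hfix _ (Or.inr (by simp))
    have hs : (absoluteGaloisGroup.toAlgEquiv (v.adicCompletion K) τ) C.s = C.s := hfix _ (Or.inr (by simp))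
    have ht' : (absoluteGaloisGroup.toAlgEquiv (v.adicCompletion K) τ) C.t = C.t := hfix _ (Or.inr (by simp))
    exact variableChange_map_eq_of_apply_eq C _ hu hr hs ht'
  set Rat : AddSubgroup (W₀.baseChange (AlgebraicClosure (v.adicCompletion K))).toAffine.Point :=
    { carrier := {P | ∀ τ : (absoluteGaloisGroup (v.adicCompletion K)), absoluteGaloisGroup.toAlgEquiv (v.adicCompletion K) τ ∈ Kn.fixingSubgroup → T τ P = P}
      add_mem' := fun {P Q} hP hQ τ hτ ↦ by rw [map_add, hP τ hτ, hQ τ hτ]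
      zero_mem' := fun τ _ ↦ map_zero _
      neg_mem' := fun {P} hP τ hτ ↦ by rw [map_neg, hP τ hτ] } with hRatdef
  have hRat_mem : ∀ P, P ∈ Rat ↔ ∀ τ : (absoluteGaloisGroup (v.adicCompletion K)), absoluteGaloisGroup.toAlgEquiv (v.adicCompletion K) τ ∈ Kn.fixingSubgroup → T τ P = P := fun _ ↦ Iff.rfl
  have hKn_mem : ∀ z : (AlgebraicClosure (v.adicCompletion K)), z ∈ Kn ↔ ∀ τ : (absoluteGaloisGroup (v.adicCompletion K)), absoluteGaloisGroup.toAlgEquiv (v.adicCompletion K) τ ∈ Kn.fixingSubgroup → σ τ z = z :=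
    fun z ↦ mem_iff_forall_smul_eq Kn z
  have hRat_coords : ∀ {X Y : (AlgebraicClosure (v.adicCompletion K))} {h : (W₀.baseChange (AlgebraicClosure (v.adicCompletion K))).toAffine.Nonsingular X Y},
      (.some X Y h) ∈ Rat ↔ X ∈ Kn ∧ Y ∈ Kn := by
    intro X Y h
    rw [hRat_mem, hKn_mem, hKn_mem]
    constructor
    · intro hP
      refine ⟨fun τ hτ ↦ ?_, fun τ hτ ↦ ?_⟩ <;>
      · obtain ⟨h', e⟩ := hTsome τ (hKnC τ hτ) (x := X) (y := Y) (h := h)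
        have := (e.symm.trans (hP τ hτ))
        simp only [WeierstrassCurve.Affine.Point.some.injEq] at this
        first | exact this.1 | exact this.2
    · rintro ⟨hX, hY⟩ τ hτ
      obtain ⟨h', e⟩ := hTsome τ (hKnC τ hτ) (x := X) (y := Y) (h := h)
      rw [e]
      exact point_some_eq_some (hX τ hτ) (hY τ hτ)
  have hRatU' : ∀ u : G, u ∈ U → absoluteGaloisGroup.toAlgEquiv (v.adicCompletion K) (u : (absoluteGaloisGroup (v.adicCompletion K))) ∈ Kn.fixingSubgroup := by
    intro u hu
    rw [IntermediateField.mem_fixingSubgroup_iff]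
    exact hUKn u hu
  have hRatT : ∀ g : G, ∀ P ∈ Rat, T (g : (absoluteGaloisGroup (v.adicCompletion K))) P ∈ Rat := by
    intro g P hP
    rcases P with _ | ⟨X, Y, h⟩
    · rw [← WeierstrassCurve.Affine.Point.zero_def, map_zero]; exact Rat.zero_mem
    · obtain ⟨hX, hY⟩ := hRat_coords.mp hP
      obtain ⟨h', e⟩ := hTsome _ (hGC' g) (x := X) (y := Y) (h := h)
      rw [e, hRat_coords, hσ, hσ]
      exact ⟨hKnG g X hX, hKnG g Y hY⟩
  have hRatz : ∀ P ∈ Rat, P ∈ kernel w (W₀.baseChange (AlgebraicClosure (v.adicCompletion K))) → P.zCoord ∈ Kn.toSubfield := by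
    intro P hP _
    rcases P with _ | ⟨X, Y, h⟩
    · rw [← WeierstrassCurve.Affine.Point.zero_def, WeierstrassCurve.Affine.Point.zCoord_zero]
      exact Kn.toSubfield.zero_mem
    · obtain ⟨hX, hY⟩ := hRat_coords.mp hP
      rw [WeierstrassCurve.Affine.Point.zCoord_some]
      exact Kn.toSubfield.div_mem (Kn.toSubfield.neg_mem hX) hY
  have hlift : ∀ z ∈ Kn.toSubfield, w z < 1 →
      ∃ P ∈ kernel w (W₀.baseChange (AlgebraicClosure (v.adicCompletion K))), P ∈ Rat ∧ P.zCoord = z := by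
    intro z hz hz1
    obtain ⟨P, hPK, hPz⟩ :=
      exists_mem_kernel_zCoord_eq_of_isAlgClosed (V := W₀.baseChange (AlgebraicClosure (v.adicCompletion K))) (w := w) hz1
    refine ⟨P, hPK, (hRat_mem P).mpr fun τ hτ ↦ ?_, hPz⟩
    obtain ⟨hTK, hTz⟩ := hTC_ker τ (hKnC τ hτ) P hPK
    refine eq_of_mem_kernel_of_zCoord_eq hTK hPK ?_
    rw [hTz, hPz]
    rw [IntermediateField.mem_fixingSubgroup_iff] at hτ
    exact hτ z hz
  have hcomplete : ∀ θ : ℝ≥0, θ < 1 → ∀ a : ℕ → (AlgebraicClosure (v.adicCompletion K)),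
      (∀ r, a r ∈ Kn.toSubfield) → (∀ r, w (a (r + 1) - a r) ≤ θ ^ (r + 1)) →
      ∃ z ∈ Kn.toSubfield, ∀ r, w (z - a r) ≤ θ ^ (r + 1) := by
    intro θ hθ a ha hcau
    obtain ⟨y, hy⟩ := exists_limit_of_finiteDimensional hw Kn hθ (fun r ↦ ⟨a r, ha r⟩) hcau
    exact ⟨y, y.2, hy⟩
  have hcR : ∀ g, c g ∈ Rat := by
    intro g
    rcases hQ : c g with _ | ⟨X, Y, h⟩
    · exact Rat.zero_mem
    · rw [hRat_coords]
      have hXS : X ∈ S₀ := Or.inl ⟨c g, ⟨g, rfl⟩, X, Y, h, hQ, Or.inl rfl⟩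
      have hYS : Y ∈ S₀ := Or.inl ⟨c g, ⟨g, rfl⟩, X, Y, h, hQ, Or.inr rfl⟩
      exact ⟨hM₁Kn (hS₀M₁ hXS), hM₁Kn (hS₀M₁ hYS)⟩
  obtain ⟨θ, hθ1, hρ₀θ⟩ : ∃ θ : ℝ≥0, θ < 1 ∧ ρ₀ = w (∑ q : G ⧸ U, σ ((q.out : G) : (absoluteGaloisGroup (v.adicCompletion K))) x) ^ 2 * θ := by
    have hη2pos : 0 < w (∑ q : G ⧸ U, σ ((q.out : G) : (absoluteGaloisGroup (v.adicCompletion K))) x) ^ 2 := pow_pos hηpos 2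
    exact ⟨ρ₀ / _ ^ 2, by rw [div_lt_one hη2pos]; exact hη2, by rw [mul_div_cancel₀ _ hη2pos.ne']⟩
  have hcz : ∀ g, w (c g).zCoord ≤ w (∑ q : G ⧸ U, σ ((q.out : G) : (absoluteGaloisGroup (v.adicCompletion K))) x) ^ 2 * θ :=
    fun g ↦ hρ₀θ ▸ hcρ₀ g
  obtain ⟨P, hPK, -, hP⟩ := AlmostEtale.exists_forall_eq_sub_of_cocycle_of_trace
    (V := W₀.baseChange (AlgebraicClosure (v.adicCompletion K))) (w := w) (U := U) (σ := fun g : G ↦ σ (g : (absoluteGaloisGroup (v.adicCompletion K))))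
    (T := fun g : G ↦ T (g : (absoluteGaloisGroup (v.adicCompletion K)))) (S := Kn.toSubfield) (Rat := Rat) (x := x)
    (fun g h z ↦ by rw [Subgroup.coe_mul, hσ, hσ, hσ, mul_smul]) (fun g z ↦ hσw _ z)
    (fun g h Q ↦ by rw [Subgroup.coe_mul]; exact hTmul _ _ Q)
    (fun g Q hQ ↦ (hTC_ker _ (hGC' g) Q hQ).1) (fun g Q hQ ↦ (hTC_ker _ (hGC' g) Q hQ).2)
    (fun g s hs ↦ by rw [hσ]; exact hKnG g s hs) (fun u hu s hs ↦ by rw [hσ]; exact hUKn u hu s hs)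
    hRatT (fun u hu Q hQ ↦ hQ _ (hRatU' u hu)) hRatz hlift hcomplete hx1 hxKn hηpos hθ1
    hcoc hcK hcR hcU hcz
  refine ⟨Φ.symm P, ?_, fun g ↦ ?_⟩
  · rw [← hΦ, AddEquiv.apply_symm_apply, mem_kernelOfReduction_iff, ← mem_kernel_iff_reducesToZero W₀]
    exact hPK
  · apply Φ.injective
    rw [map_sub, ← hc_apply, hP g, hT, AddEquiv.apply_symm_apply]
    rfl

end Summit.BirchSwinnertonDyer.BirchSwinnertonDyer.Theorems.KernelH1OfTrace

end
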